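import Summits.AtomisticToContinuum.HydrodynamicLimit.Theorems.AntiMazurCoboundariesKineticWindowGronwallEndState
import Summits.AtomisticToContinuum.HydrodynamicLimit.Theorems.AntiMazurCoboundariesKineticWindowGronwallRareBandDockUniformRange
import Summits.AtomisticToContinuum.HydrodynamicLimit.Theorems.AntiMazurCoboundariesKineticWindowGronwallFramePrelim
import Summits.AtomisticToContinuum.HydrodynamicLimit.Theorems.AntiMazurCoboundariesKineticWindowGronwallCollarLocalityAE
import Literature.Analysis.FluidPDE.HardSphereAlexander
import HarnessLib

/-!
# The rare band docks on the board: `TwoClocks.EquilibriumFastWindowLD` ⟹ the quadratic class, the rare band, the antecedent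

Crux `Summit.AtomisticToContinuum.HydrodynamicLimit.Theses.AntiMazurCoboundaries.KineticWindowGronwall`
(stmt-AtomisticToContinuum-9282, `= KineticFluxLdDecay → RelEntropyVanishing`; shared verbatim with route FluxGibbsianityLdDrude),
line `rare-band-ladder-dock`, helper file 2 of 2 of lead c4 (`--supports` the crux; file 1: `…RareBandDockUniformRange`, the Baire
uniform tilt range). The line's end state (landed, `KineticWindowGronwallEndState.kineticWindowGronwall_of_open`) reduces the crux to
three open inputs `RareBandLdDecay → LocalTransferQ → SharedInputs → KineticWindowGronwall`, the first being the line's one NEW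
equilibrium large-deviation lemma. THIS FILE DOCKS IT ON AN EXISTING BOARD CRUX: the TwoClocks crux `EquilibriumFastWindowLD`
(stmt-AtomisticToContinuum-14440: window LD at global equilibrium for every continuous fast one-body `F(x, v)` of quadratic growth,
tilt range AFTER the observable, flow family BEFORE it) implies the line's `QuadraticClassLdDecay` (amplitude `c⋆` BEFORE the
observable, flow innermost, "window of the sum" shape), hence `RareBandLdDecay` and the crux's own antecedent `KineticFluxLdDecay`
(stmt-10967), by kernel-checked glue and NO dynamics:

* file 1 — AUTOMATIC UNIFORMITY of the tilt range over weighted sup-norm balls, eventual window (Baire);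
* `lintegral_window_flow_indep'` / `lintegral_window_prod_eq` — FLOW INDEPENDENCE of window exponential moments under the
  homogeneous law (every hard-sphere flow agrees with Alexander's canonical flow a.e. forward in time,
  `KineticWindowGronwallFrame.lintegral_window_congr_regFlow`; flows exist at every `N` for `σ < 1/2`,
  `HardSphereFlow.nonempty_torus_holds`) and the sum/time-integral interchange along good orbits — this moves the flow
  quantifier from outside (`∀ Φ` before `F`) to innermost (`∀ Φ` after `N`) and the shape from "sum of windows" to "window of the sum";
* `integral_frame_mul_localMaxwellian` / `orth_localMaxwellian_of_orth` — the Gaussian FRAME CHANGE `v = u₀ + √θ w` turning the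
  line's `Orth g` (standard Gaussian, scaled peculiar velocity) into 14440's orthogonality at every `x` under `M_{1,u₀,θ}`.

Consequences recorded: `rareBandLdDecay_of_equilibriumFastWindowLD`, `kineticFluxLdDecay_of_equilibriumFastWindowLD` (TwoClocks'
crux 14440 implies AntiMazur/FluxGibbsianity's crux 10967), and the line's end state re-docked:
`kineticWindowGronwall_of_equilibriumFastWindowLD : EquilibriumFastWindowLD → LocalTransferQ → SharedInputs → KineticWindowGronwall`
— after this file the crux's open inputs are board items (14440; LCTF, CSCV-W, 16624, 9235, 3091) plus the one shared kinetic wall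
`LocalTransferQ` (= TwoClocks 14443 / 16625-S3b in product form).

References: S. Olla, S. R. S. Varadhan, H.-T. Yau, Comm. Math. Phys. 155 (1993) §2; I. Gallagher, L. Saint-Raymond, B. Texier
(2013) Prop. 4.1.1 (a.e. uniqueness of the hard-sphere flow); W. Rudin, *Functional Analysis* (1991) Thm 2.5.
-/

noncomputable section

open MeasureTheory ProbabilityTheory Real Set Filter
open scoped ENNReal BigOperators BoundedContinuousFunction

namespace Summit.AtomisticToContinuum.HydrodynamicLimit.Theorems.KineticWindowGronwallRareBandDock

open Literature.Analysis.FluidPDE Literature.MathematicalPhysics.KineticTheory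
open Summit.AtomisticToContinuum.HydrodynamicLimit.Theses.AntiMazurCoboundaries (KineticFluxLdDecay RelEntropyVanishing
  KineticWindowGronwall)
open Summit.AtomisticToContinuum.HydrodynamicLimit.Theses.TwoClocks (EquilibriumFastWindowLD)
open Summit.AtomisticToContinuum.HydrodynamicLimit.Theorems.KineticWindowGronwallLadder (TFlow Orth RareBandLdDecay
  QuadraticClassLdDecay)
open Summit.AtomisticToContinuum.HydrodynamicLimit.Theorems.KineticWindowGronwallEndState (LocalTransferQ SharedInputs
  kineticWindowGronwall_of_open rareBand_of_quadraticClass kineticFluxLdDecay_of_quadraticClass)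

/-! ## §1 The Gaussian frame change of the orthogonality clause -/

/-- **Frame change.** For `θ > 0`, a drift `u₀`, a velocity profile `G` read in the scaled peculiar velocity `w = (v − u₀)/√θ`
and any weight `p`: `∫ G(w(v)) p(v) M_{1,u₀,θ}(v) dv = ∫ G(w) p(u₀ + √θ w) dγ(w)` (`γ` the standard Gaussian;
`integral_localMaxwellian_smul`). [folklore] -/
theorem integral_frame_mul_localMaxwellian {θ : ℝ} (hθ : 0 < θ) (u₀ : V3) (G : V3 → ℝ) (p : V3 → ℝ) :
    ∫ v, G ((Real.sqrt θ)⁻¹ • (v - u₀)) * p v * localMaxwellian 1 θ u₀ v =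
      ∫ w, G w * p (u₀ + Real.sqrt θ • w) ∂(stdGaussian V3) := by
  have hs : Real.sqrt θ ≠ 0 := (Real.sqrt_pos.2 hθ).ne'
  have e : (fun v : V3 => G ((Real.sqrt θ)⁻¹ • (v - u₀)) * p v * localMaxwellian 1 θ u₀ v) =
      fun v => localMaxwellian 1 θ u₀ v • (G ((Real.sqrt θ)⁻¹ • (v - u₀)) * p v) := by
    funext v; rw [smul_eq_mul]; ring
  rw [e, integral_localMaxwellian_smul hθ u₀]
  refine integral_congr_ae (ae_of_all _ fun w => ?_)
  simp only [add_sub_cancel_left, smul_smul, inv_mul_cancel₀ hs, one_smul]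

/-- **`Orth g` gives 14440's three orthogonality clauses** for the product observable `F(x,v) = c φ(x) g((v − u₀)/√θ)` at every `x`:
against `1`, `v_j` and `‖v‖²` under `M_{1,u₀,θ}` — the frame change turns the weights into `1`, `u₀ⱼ + ⟨√θ eⱼ, w⟩`,
`‖u₀‖² + ⟨2√θ u₀, w⟩ + θ‖w‖²`, all in `span{1, w, ‖w‖²}`. [folklore] -/
theorem orth_localMaxwellian_of_orth {θ : ℝ} (hθ : 0 < θ) (u₀ : V3) {g : V3 → ℝ} (horth : Orth g) (c : ℝ) (φ : T3 → ℝ)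
    (x : T3) :
    (∫ v, c * (φ x * g ((Real.sqrt θ)⁻¹ • (v - u₀))) * localMaxwellian 1 θ u₀ v = 0) ∧
    (∀ j : Fin 3, ∫ v, c * (φ x * g ((Real.sqrt θ)⁻¹ • (v - u₀))) * v j * localMaxwellian 1 θ u₀ v = 0) ∧
    (∫ v, c * (φ x * g ((Real.sqrt θ)⁻¹ • (v - u₀))) * ‖v‖ ^ 2 * localMaxwellian 1 θ u₀ v = 0) := by
  have key : ∀ p : V3 → ℝ, (∃ (c₀ c₂ : ℝ) (b : V3), ∀ w, p (u₀ + Real.sqrt θ • w) = c₀ + inner ℝ b w + c₂ * ‖w‖ ^ 2) →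
      ∫ v, c * (φ x * g ((Real.sqrt θ)⁻¹ • (v - u₀))) * p v * localMaxwellian 1 θ u₀ v = 0 := by
    rintro p ⟨c₀, c₂, b, hp⟩
    have e : (fun v : V3 => c * (φ x * g ((Real.sqrt θ)⁻¹ • (v - u₀))) * p v * localMaxwellian 1 θ u₀ v) =
        fun v => (c * φ x) * (g ((Real.sqrt θ)⁻¹ • (v - u₀)) * p v * localMaxwellian 1 θ u₀ v) := by
      funext v; ring
    rw [e, integral_const_mul, integral_frame_mul_localMaxwellian hθ u₀ g p]
    have e2 : (fun w : V3 => g w * p (u₀ + Real.sqrt θ • w)) = fun w => g w * (c₀ + inner ℝ b w + c₂ * ‖w‖ ^ 2) := by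
      funext w; rw [hp w]
    rw [e2, horth c₀ c₂ b, mul_zero]
  refine ⟨?_, fun j => ?_, ?_⟩
  · have h := key (fun _ => (1 : ℝ)) ⟨1, 0, 0, fun w => by simp⟩
    simpa only [mul_one] using h
  · refine key (fun v => v j) ⟨u₀ j, 0, EuclideanSpace.single j (Real.sqrt θ), fun w => ?_⟩
    rw [EuclideanSpace.inner_single_left]
    simp
  · refine key (fun v => ‖v‖ ^ 2) ⟨‖u₀‖ ^ 2, θ, (2 * Real.sqrt θ) • u₀, fun w => ?_⟩
    rw [norm_add_sq_real, real_inner_smul_left, real_inner_smul_right, norm_smul, mul_pow, Real.norm_eq_abs,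
      sq_abs, Real.sq_sqrt hθ.le]
    ring

/-! ## §2 Flow independence and the shape of the window functional -/

/-- **Flow independence of window functionals under the homogeneous law** ("window of the sum" shape, any integrand `F` on phase
space, any outer function `H`): two flows of the same type give the same `lintegral` — both agree with Alexander's canonical flow
a.e. forward in time (`KineticWindowGronwallFrame.lintegral_window_congr_regFlow`) and the law does not depend on the flow argument.
[cite: GST2013, Prop. 4.1.1] -/
theorem lintegral_window_flow_indep' {σ : ℝ} (hσ : 0 < σ) (hσh : σ < 2⁻¹) (a θ : ℝ) (u₀ : V3) (N : ℕ) (Φ Ψ : TFlow σ N)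
    (H : ℝ → ℝ≥0∞) (F : Config (N + 1) (Fin 3) T3 → ℝ) {h : ℝ} (hh : 0 ≤ h) :
    ∫⁻ z, H (∫ s in (0 : ℝ)..h, F (Φ.flow s z)) ∂(localGibbsLaw σ (fun _ => a) (fun _ => u₀) (fun _ => θ) N Φ) =
      ∫⁻ z, H (∫ s in (0 : ℝ)..h, F (Ψ.flow s z)) ∂(localGibbsLaw σ (fun _ => a) (fun _ => u₀) (fun _ => θ) N Ψ) := by
  have hε := hsDiameter_pos hσ N
  have hε' := KineticWindowGronwallFrame.hsDiameter_lt_half hσ hσh N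
  rw [KineticWindowGronwallFrame.lintegral_window_congr_regFlow hε hε' Φ
      (KineticWindowGronwallCollarLocality.localGibbsLaw_absolutelyContinuous σ _ _ _ N Φ) H F hh,
    KineticWindowGronwallFrame.lintegral_window_congr_regFlow hε hε' Ψ
      (KineticWindowGronwallCollarLocality.localGibbsLaw_absolutelyContinuous σ _ _ _ N Ψ) H F hh,
    localGibbsLaw_eq, localGibbsLaw_eq]

/-- **The line's window functional of a product observable, through ANY flow, equals 14440's tilted "sum of windows" functional of
the rescaled observable through ANY OTHER flow.** For continuous `φ, g`, `b ≠ 0`, `h ≥ 0` and flows `Φ, Ψ` of the same type: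
`∫⁻ exp(h⁻¹∫₀ʰ Σᵢ φ(xᵢ)g(wᵢ) ds ∘ Φ) dG_N = ∫⁻ exp(b Σᵢ h⁻¹∫₀ʰ b⁻¹φ(xᵢ)g(wᵢ) dr ∘ Ψ) dG_N` — sum/time-integral interchange along the
good orbits of `Ψ` (continuous observables are interval integrable there, `HardSphereFlow.intervalIntegrable_comp_flow_of_continuous`;
the good set carries `G_N`), then flow independence. [folklore] -/
theorem lintegral_window_prod_eq {σ : ℝ} (hσ : 0 < σ) (hσh : σ < 2⁻¹) (a θ : ℝ) (u₀ : V3) (N : ℕ) (Φ Ψ : TFlow σ N)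
    {φ : T3 → ℝ} {g : V3 → ℝ} (hφ : Continuous φ) (hg : Continuous g) {b : ℝ} (hb : b ≠ 0) {h : ℝ} (hh : 0 ≤ h) :
    ∫⁻ z, ENNReal.ofReal (Real.exp (h⁻¹ * ∫ s in (0 : ℝ)..h,
        ∑ i, φ (Φ.flow s z i).1 * g ((Real.sqrt θ)⁻¹ • ((Φ.flow s z i).2 - u₀))))
        ∂(localGibbsLaw σ (fun _ => a) (fun _ => u₀) (fun _ => θ) N Φ) =
      ∫⁻ z, ENNReal.ofReal (Real.exp (b * ∑ i : Fin (N + 1), (h⁻¹ *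
        ∫ r in (0 : ℝ)..h, b⁻¹ * (φ (Ψ.flow r z i).1 * g ((Real.sqrt θ)⁻¹ • ((Ψ.flow r z i).2 - u₀))))))
        ∂(localGibbsLaw σ (fun _ => a) (fun _ => u₀) (fun _ => θ) N Ψ) := by
  -- move the left-hand side to the flow `Ψ`
  rw [lintegral_window_flow_indep' hσ hσh a θ u₀ N Φ Ψ (fun y => ENNReal.ofReal (Real.exp (h⁻¹ * y)))
    (fun y : Config (N + 1) (Fin 3) T3 => ∑ i, φ (y i).1 * g ((Real.sqrt θ)⁻¹ • ((y i).2 - u₀))) hh]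
  -- interchange sum and time integral along the good orbits of `Ψ`
  refine lintegral_congr_ae ?_
  filter_upwards [KineticWindowGronwallQuadraticMoment.ae_mem_good_localGibbsLaw σ (fun _ => a) (fun _ => u₀) (fun _ => θ) N Ψ]
    with z hz
  congr 2
  have hint : ∀ i : Fin (N + 1), IntervalIntegrable
      (fun r => b⁻¹ * (φ (Ψ.flow r z i).1 * g ((Real.sqrt θ)⁻¹ • ((Ψ.flow r z i).2 - u₀)))) volume 0 h := by
    intro i
    have hc : Continuous fun y : Config (N + 1) (Fin 3) T3 =>
        b⁻¹ * (φ (y i).1 * g ((Real.sqrt θ)⁻¹ • ((y i).2 - u₀))) := by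
      have hi : Continuous fun y : Config (N + 1) (Fin 3) T3 => y i := continuous_apply i
      have hsm : Continuous fun y : Config (N + 1) (Fin 3) T3 => (Real.sqrt θ)⁻¹ • ((y i).2 - u₀) := by fun_prop
      exact continuous_const.mul ((hφ.comp hi.fst).mul (hg.comp hsm))
    exact Ψ.intervalIntegrable_comp_flow_of_continuous hz hc 0 h
  have hsum : (∫ s in (0 : ℝ)..h, ∑ i, φ (Ψ.flow s z i).1 * g ((Real.sqrt θ)⁻¹ • ((Ψ.flow s z i).2 - u₀))) =
      b * ∑ i : Fin (N + 1), ∫ r in (0 : ℝ)..h,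
        b⁻¹ * (φ (Ψ.flow r z i).1 * g ((Real.sqrt θ)⁻¹ • ((Ψ.flow r z i).2 - u₀))) := by
    rw [← intervalIntegral.integral_finsetSum fun i _ => hint i, ← intervalIntegral.integral_const_mul]
    refine intervalIntegral.integral_congr fun s _ => ?_
    simp only [Finset.mul_sum]
    refine Finset.sum_congr rfl fun i _ => ?_
    field_simp
  rw [hsum, Finset.mul_sum, Finset.mul_sum, Finset.mul_sum]
  refine Finset.sum_congr rfl fun i _ => ?_
  ring

/-! ## §3 The dock: `EquilibriumFastWindowLD` ⟹ the quadratic class, the rare band, the antecedent -/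

/-- **Registered helper stub signature `stub_rareBandDock`** (helper of `stub_rareBand`, line `rare-band-ladder-dock`): the TwoClocks crux
`EquilibriumFastWindowLD` (stmt-14440) implies the line's quadratic-class node — hence the rare band and the crux's antecedent. -/
def RareBandDock : Prop :=
  EquilibriumFastWindowLD → QuadraticClassLdDecay


/-- **THE DOCK.** `TwoClocks.EquilibriumFastWindowLD → QuadraticClassLdDecay`: given a frame `(a, θ, u₀)`, take
`σ₀' = min σ₀ ½`; for `σ < σ₀'` the homogeneous laws are probability measures (`σ ≤ ½`); fix the reference flow family given by
Alexander's theorem and the frame growth constant `C_θ = 1 + 2‖u₀‖²/θ + 2/θ` (so that `1 + ‖(v−u₀)/√θ‖² ≤ C_θ(1+‖v‖²)`); the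
uniform tilt range `β₁(C_θ)` of file 1 IS the amplitude `c⋆`: for `|g(w)| ≤ β₁(1+‖w‖²)` the rescaled product `F = β₁⁻¹ φ ⊗ g` has
growth `≤ C_θ`, is orthogonal at every `x` (§1), so the eventual bound holds at tilt `β₁` through the reference flows — and through
every flow, in the line's "window of the sum" shape, by §2. [cite: Rudin1991, Thm 2.5] -/
theorem quadraticClassLdDecay_of_equilibriumFastWindowLD (hE : EquilibriumFastWindowLD) : QuadraticClassLdDecay := by
  obtain ⟨σ₀, hσ₀, hU⟩ := uniformWindowLD_of_equilibriumFastWindowLD hE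
  intro a θ u₀ ha hθ
  refine ⟨min σ₀ 2⁻¹, lt_min hσ₀ (by norm_num), fun σ hσ hσlt => ?_⟩
  have hσ₀' : σ < σ₀ := hσlt.trans_le (min_le_left _ _)
  have hσh : σ < 2⁻¹ := hσlt.trans_le (min_le_right _ _)
  have hσ2 : σ ≤ 1 / 2 := by rw [one_div]; exact hσh.le
  refine ⟨fun N Φ => isProbabilityMeasure_localGibbsLaw continuous_const continuous_const continuous_const
    (fun _ => ha) (fun _ => hθ) hσ2 N Φ, ?_⟩
  -- the reference flow family (Alexander)
  set Φ₀ : (N : ℕ) → TFlow σ N := fun N =>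
    Classical.choice (HardSphereFlow.nonempty_torus_holds (hsDiameter_pos hσ N)
      (KineticWindowGronwallFrame.hsDiameter_lt_half hσ hσh N) (N + 1)) with hΦ₀
  -- the frame growth constant
  set Cθ : ℝ := 1 + 2 * ‖u₀‖ ^ 2 / θ + 2 / θ with hCθ
  have hCθ0 : 0 ≤ Cθ := by positivity
  obtain ⟨β₁, hβ₁, H⟩ := hU a θ u₀ ha hθ σ hσ hσ₀' Φ₀ Cθ hCθ0
  refine ⟨β₁, hβ₁, fun φ g hφ hg hφ1 hgc horth δ hδ => ?_⟩
  -- the rescaled product observable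
  set F : T3 × V3 → ℝ := fun y => β₁⁻¹ * (φ y.1 * g ((Real.sqrt θ)⁻¹ • (y.2 - u₀))) with hF
  have hFc : Continuous F := by
    have hsm : Continuous fun y : T3 × V3 => (Real.sqrt θ)⁻¹ • (y.2 - u₀) := by fun_prop
    exact continuous_const.mul ((hφ.comp continuous_fst).mul (hg.comp hsm))
  have hs : 0 < Real.sqrt θ := Real.sqrt_pos.2 hθ
  have hframe : ∀ v : V3, 1 + ‖(Real.sqrt θ)⁻¹ • (v - u₀)‖ ^ 2 ≤ Cθ * (1 + ‖v‖ ^ 2) := by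
    intro v
    have h1 : ‖(Real.sqrt θ)⁻¹ • (v - u₀)‖ ^ 2 = ‖v - u₀‖ ^ 2 / θ := by
      rw [norm_smul, mul_pow, norm_inv, Real.norm_eq_abs, abs_of_pos hs, inv_pow, Real.sq_sqrt hθ.le]
      ring
    have h2 : ‖v - u₀‖ ^ 2 ≤ 2 * ‖v‖ ^ 2 + 2 * ‖u₀‖ ^ 2 := by
      have := norm_sub_le v u₀
      nlinarith [norm_nonneg (v - u₀), norm_nonneg v, norm_nonneg u₀, sq_nonneg (‖v‖ - ‖u₀‖)]
    rw [h1, hCθ]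
    have hθ' : 0 < θ := hθ
    have h3 : (1 + ‖v - u₀‖ ^ 2 / θ) * θ = θ + ‖v - u₀‖ ^ 2 := by field_simp
    have h4 : (1 + 2 * ‖u₀‖ ^ 2 / θ + 2 / θ) * (1 + ‖v‖ ^ 2) * θ =
        (θ + 2 * ‖u₀‖ ^ 2 + 2) * (1 + ‖v‖ ^ 2) := by field_simp
    have key : (1 + ‖v - u₀‖ ^ 2 / θ) * θ ≤ (1 + 2 * ‖u₀‖ ^ 2 / θ + 2 / θ) * (1 + ‖v‖ ^ 2) * θ := by
      rw [h3, h4]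
      nlinarith [sq_nonneg ‖v‖, sq_nonneg ‖u₀‖, mul_nonneg hθ'.le (sq_nonneg ‖v‖),
        mul_nonneg (sq_nonneg ‖u₀‖) (sq_nonneg ‖v‖)]
    exact le_of_mul_le_mul_right key hθ'
  have hFb : ∀ y, |F y| ≤ Cθ * (1 + ‖y.2‖ ^ 2) := by
    intro y
    rw [hF]
    dsimp only
    rw [abs_mul, abs_mul, abs_inv, abs_of_pos hβ₁]
    calc β₁⁻¹ * (|φ y.1| * |g ((Real.sqrt θ)⁻¹ • (y.2 - u₀))|)
        ≤ β₁⁻¹ * (1 * (β₁ * (1 + ‖(Real.sqrt θ)⁻¹ • (y.2 - u₀)‖ ^ 2))) := by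
          refine mul_le_mul_of_nonneg_left (mul_le_mul (hφ1 _) (hgc _) (abs_nonneg _) zero_le_one) ?_
          exact inv_nonneg.2 hβ₁.le
      _ = 1 + ‖(Real.sqrt θ)⁻¹ • (y.2 - u₀)‖ ^ 2 := by field_simp
      _ ≤ Cθ * (1 + ‖y.2‖ ^ 2) := hframe y.2
  have hO := fun x => orth_localMaxwellian_of_orth hθ u₀ horth β₁⁻¹ φ x
  obtain ⟨τ₀, hτ₀, Hτ⟩ := H F hFc hFb (fun x => (hO x).1) (fun x j => (hO x).2.1 j) (fun x => (hO x).2.2) β₁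
    (by rw [abs_of_pos hβ₁]) δ hδ
  obtain ⟨N₀, hN⟩ := Hτ τ₀ le_rfl
  refine ⟨τ₀, hτ₀, N₀, fun N hNN Φ => ?_⟩
  have hmain := hN N hNN
  have hcast : ((N + 1 : ℕ) : ℝ) = (N : ℝ) + 1 := by push_cast; ring
  have hh : 0 ≤ τ₀ * ((N : ℝ) + 1) ^ (-(1 / 3 : ℝ)) := mul_nonneg hτ₀.le (Real.rpow_nonneg (by positivity) _)
  rw [hcast, lintegral_window_prod_eq hσ hσh a θ u₀ N Φ (Φ₀ N) hφ hg hβ₁.ne' hh]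
  simpa only [hF] using hmain

/-- **The rare band docks on the board**: `TwoClocks.EquilibriumFastWindowLD → RareBandLdDecay` (the band class sits inside the
quadratic class, `KineticWindowGronwallEndState.rareBand_of_quadraticClass`). [folklore] -/
theorem rareBandLdDecay_of_equilibriumFastWindowLD (hE : EquilibriumFastWindowLD) : RareBandLdDecay :=
  rareBand_of_quadraticClass (quadraticClassLdDecay_of_equilibriumFastWindowLD hE)

/-- **Registered helper stub `stub_rareBandDock`** (same term as `quadraticClassLdDecay_of_equilibriumFastWindowLD`). [folklore] -/
theorem stub_rareBandDock : RareBandDock :=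
  quadraticClassLdDecay_of_equilibriumFastWindowLD

/-- **TwoClocks' crux 14440 implies the crux's antecedent** (AntiMazur/FluxGibbsianity stmt-10967): `EquilibriumFastWindowLD →
KineticFluxLdDecay` (the bounded class sits inside the quadratic class). [folklore] -/
theorem kineticFluxLdDecay_of_equilibriumFastWindowLD (hE : EquilibriumFastWindowLD) : KineticFluxLdDecay :=
  kineticFluxLdDecay_of_quadraticClass (quadraticClassLdDecay_of_equilibriumFastWindowLD hE)

/-- **THE LINE'S END STATE, RE-DOCKED ON THE BOARD.** `EquilibriumFastWindowLD → LocalTransferQ → SharedInputs →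
KineticWindowGronwall`: with this file the rare band is no longer new exposure — the crux follows from the TwoClocks crux 14440, the
shared kinetic wall `LocalTransferQ` (= TwoClocks 14443 / 16625-S3b in product form) and the five board inputs of the landed heart
(the crux's antecedent entering the landed ladder as before). [cite: OllaVaradhanYau1993, §2–3] -/
theorem kineticWindowGronwall_of_equilibriumFastWindowLD (hE : EquilibriumFastWindowLD) (h₄ : LocalTransferQ)
    (h₇ : SharedInputs) : KineticWindowGronwall :=
  kineticWindowGronwall_of_open (rareBandLdDecay_of_equilibriumFastWindowLD hE) h₄ h₇

/-- The same for the item's primary decl (route FluxGibbsianityLdDrude; same term). [folklore] -/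
theorem kineticWindowGronwall_of_equilibriumFastWindowLD' (hE : EquilibriumFastWindowLD) (h₄ : LocalTransferQ)
    (h₇ : SharedInputs) : Summit.AtomisticToContinuum.HydrodynamicLimit.Theses.FluxGibbsianityLdDrude.KineticWindowGronwall :=
  kineticWindowGronwall_of_equilibriumFastWindowLD hE h₄ h₇

end Summit.AtomisticToContinuum.HydrodynamicLimit.Theorems.KineticWindowGronwallRareBandDock

end
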